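import Mathlib
import Literature.NumberTheory.LFunctions.Zhang2022.SkeletonPropositions
import Literature.NumberTheory.LFunctions.Zhang2022.Section7MeanSquareMajorant
import Literature.NumberTheory.LFunctions.Zhang2022.Section8Reflection
import HarnessLib

/-!
# Zhang (2022), typed skeleton VII: Part II nodes — §7 (the mean-value formula I, Proposition
# 7.1) and §8 Lemma 8.1, with the sequences `𝐚₁₁, 𝐚₂₁, 𝐚₁₂, 𝐚₂₂, 𝐚₁₃, 𝐚₁₄, 𝐚₂₃` and the
# reductions (8.7), (9.1), (10.1), (18.3)

Topic `Literature/NumberTheory/LFunctions/Zhang2022` (Landau–Siegel audit tree; verdict-neutral).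
Y. Zhang, *Discrete mean estimates and the Landau–Siegel zero*, arXiv:2211.02515v1 (2022)
[Zhang2022LandauSiegel] — **an unrefereed manuscript under adjudication; every `def … : Prop` below
is a CLAIM OF THE MANUSCRIPT, STATED NOT ASSERTED.** These are the nodes through which EVERY
main-term evaluation of the manuscript passes ((8.23), (9.7), (10.17), (18.3) and, via §§12–17,
(18.1)): a gap located in §7 or in Lemma 8.1 maps here.

Objects (§7 p. 13): `nset d` (`𝔫(d)`), `kappaZ` (`κ`, the tree's `MeanSquareMajorant.kappa` at the
real shift sizes `b_j`, `β_j = ib_j`), `kappaTilde` (`κ̃(d;m,s)`, a series), `lam` (`λ(m,s)`),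
`betaJ` (`β_j` with the convention `β₄ = β₁, β₅ = β₂` of §8), `lamZero`, `kappaTildeZero`,
`lamTildeZero`, `xiZero` (`λ₀ⱼ, κ̃₀ⱼ, λ̃₀ⱼ, ξ₀ⱼ(n;d,r)`), `frakcW` (`𝔠(s,ψ)`, (7.1)), `Adm72`
((7.2)), `Apoly`, `ApolyBar` (`A(𝐚;s,ψ)`, `A(𝐚;s,ψ̄)`, the tree's `Lemma81.dirPoly`), `Theta1`
(the tree's `Lemma81.segInt` on `𝔍(1)`), `Sj`, `Ecal` (`S_j(𝐚₁,𝐚₂)`, `E(𝐚₁,𝐚₂)`), `lhs81`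
(the left side of Lemma 8.1), and the sequences `a11 … a23` of (8.8), (9.2), §10, §18.

| node | locator | printed claim |
|---|---|---|
| `Prop71 c′` | §7 Prop. 7.1 | `Θ₁(𝐚₁,𝐚₂) = α⁻¹(½S₁ + 2S₂ + 3/2S₃)𝔓 + O(E(𝐚₁,𝐚₂)) + o(𝔓)` |
| `Lemma81 c′` | §8 Lemma 8.1 | `ΣΣ𝔠*A(𝐚₁;ρ,ψ)A(𝐚₂;1−ρ,ψ̄)ω = Θ₁(𝐚₁,𝐚₂) + conj Θ₁(𝐚̄₂,𝐚̄₁) + o(𝔓)` |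
| `Eq87 c′`, `Eq91 c′` | (8.7), (9.1) | `Ξ₁₁ = 2Re Θ₁(𝐚₁₁,𝐚₂₁) + o(𝔓)`, `Ξ₁₂ = 2Re Θ₁(𝐚₁₂,𝐚₂₂) + o(𝔓)` |
| `Eq101 c′` | (10.1) | `Ξ₁* = Θ₁(𝐚₁₁,𝐚₁₃) + conj Θ₁(𝐚₁₃,𝐚₂₁) + Θ₁(𝐚₁₄,𝐚₂₂) + conj Θ₁(𝐚₁₂,𝐚₁₄) + o(𝔓)` |
| `Eq183 c′` | (18.3) | `Ξ_J = 2Re Θ₁(𝐚₂₃,𝐚₂₃) + o(𝔓)` |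

Conventions: "`a(n) ≪ 1`" in (7.2) is typed with an explicit bound `B` (`Adm72 D B a`), and the
implied constants of Prop. 7.1 / Lemma 8.1 may depend on `B`. Series (`κ̃`) are `tsum`s (junk value
`0` if divergent — they converge absolutely where the manuscript uses them, `Re s` near `1`).

## References

* Y. Zhang, arXiv:2211.02515v1 (2022), §7 pp. 13–15, §8 p. 16, (8.7)–(8.8), (9.1)–(9.2),
  (10.1), (18.3). [cite: Zhang2022LandauSiegel, §§7–10, 18]
-/

noncomputable section

open Complex Real ComplexConjugate

namespace Literature.NumberTheory.LFunctions.Zhang2022.Skeleton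

/-! ## §7: the arithmetic objects -/

section Arithmetic

variable (c' : ℝ) (D : ℕ)

/-- The real shift sizes `b₁ = α(1 − 5c′α𝓛)` (`β₁ = ib₁`, (2.13)). [cite: Zhang2022LandauSiegel, §2 (2.13)] -/
def b1 : ℝ := alpha D * (1 - 5 * c' * alpha D * ell D)

/-- `b₂ = 2α(1 + c′α𝓛)` (`β₂ = ib₂`). [cite: Zhang2022LandauSiegel, §2 (2.13)] -/
def b2 : ℝ := 2 * alpha D * (1 + c' * alpha D * ell D)

/-- `b₃ = 3α(1 − c′α𝓛)` (`β₃ = ib₃`). [cite: Zhang2022LandauSiegel, §2 (2.13)] -/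
def b3 : ℝ := 3 * alpha D * (1 - c' * alpha D * ell D)

/-- **`β_j` with the index convention of §8**: "`β₄ = β₁, β₅ = β₂`, so that
`{β_j, β_{j+1}, β_{j+2}} = {β₁, β₂, β₃}`" (`j` is read modulo `3`). [cite: Zhang2022LandauSiegel, §8 p. 17] -/
def betaJ (j : ℕ) : ℂ :=
  if j % 3 = 1 then beta1 c' D else if j % 3 = 2 then beta2 c' D else beta3 c' D

/-- **`𝔫(d)`** (§7 p. 13): "`h ∈ 𝔫(d)` if and only if every prime factor of `h` divides `d`"
(`1 ∈ 𝔫(d)`, `𝔫(1) = {1}`). [cite: Zhang2022LandauSiegel, §7 p. 13] -/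
def nset (d : ℕ) : Set ℕ := {h | 0 < h ∧ ∀ q : ℕ, q.Prime → q ∣ h → q ∣ d}

/-- **`κ(n)`** (§7 p. 14): `Σ κ(n)n^{−s} = ζ(s+β₁)ζ(s+β₂)ζ(s+β₃)/ζ(s)` — the tree's
`MeanSquareMajorant.kappa b₁ b₂ b₃` (`β_j = ib_j`). [cite: Zhang2022LandauSiegel, §7 p. 14] -/
def kappaZ : ArithmeticFunction ℂ := MeanSquareMajorant.kappa (b1 c' D) (b2 c' D) (b3 c' D)

open scoped Classical in
/-- **`κ̃(d;m,s) = Σ_{h∈𝔫(d),(h,m)=1} κ(dh)h^{−s}`** (§7 p. 13), as a series.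
[cite: Zhang2022LandauSiegel, §7 p. 13] -/
def kappaTilde (d m : ℕ) (s : ℂ) : ℂ :=
  ∑' h : ℕ, if h ∈ nset d ∧ Nat.Coprime h m then kappaZ c' D (d * h) / (h : ℂ) ^ s else 0

/-- **`λ(m,s) = ∏_{q∣m} (1−q^{−s−β₁})(1−q^{−s−β₂})(1−q^{−s−β₃})/(1−q^{−s})`** (§7 p. 13).
[cite: Zhang2022LandauSiegel, §7 p. 13] -/
def lam (m : ℕ) (s : ℂ) : ℂ :=
  ∏ q ∈ m.primeFactors,
    (1 - (q : ℂ) ^ (-(s + beta1 c' D))) * (1 - (q : ℂ) ^ (-(s + beta2 c' D))) *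
      (1 - (q : ℂ) ^ (-(s + beta3 c' D))) / (1 - (q : ℂ) ^ (-s))

/-- `λ₀ⱼ(m) = λ(m, 1 − β_j)` (§7 p. 13). [cite: Zhang2022LandauSiegel, §7 p. 13] -/
def lamZero (j m : ℕ) : ℂ := lam c' D m (1 - betaJ c' D j)

/-- `κ̃₀ⱼ(d;m) = κ̃(d;m,1 − β_j)` (§7 p. 13). [cite: Zhang2022LandauSiegel, §7 p. 13] -/
def kappaTildeZero (j d m : ℕ) : ℂ := kappaTilde c' D d m (1 - betaJ c' D j)

/-- `λ̃₀ⱼ(n,dr) = ∏_{q∣n,(q,dr)=1} λ₀ⱼ(q)` (§7 p. 13). [cite: Zhang2022LandauSiegel, §7 p. 13] -/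
def lamTildeZero (j n dr : ℕ) : ℂ :=
  ∏ q ∈ n.primeFactors.filter (fun q => Nat.Coprime q dr), lamZero c' D j q

/-- **`ξ₀ⱼ(n;d,r) = λ̃₀ⱼ(n,dr) Σ_{n=d₁k,(k,r)=1} κ̃₀ⱼ(d₁;drk)μ(k)k^{1−β_j}/φ(k)`** (§7 p. 13).
[cite: Zhang2022LandauSiegel, §7 p. 13] -/
def xiZero (j n d r : ℕ) : ℂ :=
  lamTildeZero c' D j n (d * r) *
    ∑ k ∈ n.divisors.filter (fun k => Nat.Coprime k r),
      kappaTildeZero c' D j (n / k) (d * r * k) * (ArithmeticFunction.moebius k : ℂ) *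
        (k : ℂ) ^ (1 - betaJ c' D j) / (Nat.totient k : ℂ)

/-- The support bound `PT⁻²` of (7.2), as a natural number `⌈PT⁻²⌉`. [cite: Zhang2022LandauSiegel, §7 (7.2)] -/
def Nsupp : ℕ := ⌈bigP D / bigT D ^ 2⌉₊

/-- **(7.2)**: "`a(n) ≪ 1`, `a(n) = 0` if `n ≥ PT⁻²`", with the bound `B` explicit.
[cite: Zhang2022LandauSiegel, §7 (7.2)] -/
def Adm72 (B : ℝ) (a : ℕ → ℂ) : Prop :=
  (∀ n, ‖a n‖ ≤ B) ∧ ∀ n : ℕ, bigP D / bigT D ^ 2 ≤ n → a n = 0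

variable {D} (x : Chr D)

/-- **`𝔠(s,ψ) = −i(pt₀)^{β₃}Z(s,ψ)⁻¹L(s+β₁,ψ)L(s+β₂,ψ)L(s+β₃,ψ)/L(s,ψ)`** (7.1).
[cite: Zhang2022LandauSiegel, §7 (7.1)] -/
def frakcW (s : ℂ) : ℂ :=
  -I * (((x.p : ℝ) * t0 D : ℝ) : ℂ) ^ beta3 c' D * (GammaFactor.Zfac x.ψ s)⁻¹ *
    (x.ψ.LFunction (s + beta1 c' D) * x.ψ.LFunction (s + beta2 c' D) *
      x.ψ.LFunction (s + beta3 c' D)) / x.ψ.LFunction s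

/-- **`A(𝐚;s,ψ) = Σ_n a(n)ψ(n)n^{−s}`** (§7 p. 13; the tree's `Lemma81.dirPoly` over `n < ⌈PT⁻²⌉`).
[cite: Zhang2022LandauSiegel, §7 p. 13] -/
def Apoly (a : ℕ → ℂ) (s : ℂ) : ℂ := Lemma81.dirPoly (Nsupp D) a x.ψ s

/-- **`A(𝐚;s,ψ̄) = Σ_n a(n)ψ̄(n)n^{−s}`** (used at `1 − s`; `ψ̄ = ψ⁻¹`). [cite: Zhang2022LandauSiegel, §7 p. 13] -/
def ApolyBar (a : ℕ → ℂ) (s : ℂ) : ℂ := Lemma81.dirPoly (Nsupp D) a x.ψ⁻¹ s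

end Arithmetic

/-! ## Proposition 7.1 and Lemma 8.1 -/

section MeanValue

variable (c' : ℝ) {D : ℕ} [NeZero D] (χ : DirichletCharacter ℂ D)

/-- **`Θ₁(𝐚₁,𝐚₂) = Σ_{ψ∈Ψ₁} (1/2πi)∫_{𝔍(1)} 𝔠(s,ψ)A(𝐚₁;s,ψ)A(𝐚₂;1−s,ψ̄)ω(s)ds`** (Prop. 7.1).
[cite: Zhang2022LandauSiegel, §7 Prop. 7.1] -/
def Theta1 (a₁ a₂ : ℕ → ℂ) : ℂ :=
  ∑ x ∈ finsetOf (PsiOne χ), Lemma81.segInt (t0 D) (ell1 D) 1 fun s =>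
    frakcW c' x s * Apoly x a₁ s * ApolyBar x a₂ (1 - s) * omegaW D s

omit [NeZero D] in
/-- **`S_j(𝐚₁,𝐚₂) = Σ_dΣ_r |μ(r)|λ₀ⱼ(dr)/(drφ(r)) (Σ_m a₁(drm)m^{−(1−β_j)})(Σ_n a₂(drn)ξ₀ⱼ(n;d,r)/n)`**
(Prop. 7.1; all sums finite by (7.2), truncated at `⌈PT⁻²⌉`). [cite: Zhang2022LandauSiegel, §7 Prop. 7.1] -/
def Sj (D : ℕ) (j : ℕ) (a₁ a₂ : ℕ → ℂ) : ℂ :=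
  ∑ d ∈ Finset.Ico 1 (Nsupp D), ∑ r ∈ Finset.Ico 1 (Nsupp D),
    ((ArithmeticFunction.moebius r).natAbs : ℂ) * lamZero c' D j (d * r) /
        ((d * r : ℕ) * (Nat.totient r : ℂ)) *
      (∑ m ∈ Finset.Ico 1 (Nsupp D), a₁ (d * r * m) / (m : ℂ) ^ (1 - betaJ c' D j)) *
      (∑ n ∈ Finset.Ico 1 (Nsupp D), a₂ (d * r * n) * xiZero c' D j n d r / (n : ℂ))

omit [NeZero D] in
/-- **`E(𝐚₁,𝐚₂) = 𝔓𝓛²Σ_{1≤j≤3}|S_j(𝐚₁,𝐚₂)|`** (Prop. 7.1). [cite: Zhang2022LandauSiegel, §7 Prop. 7.1] -/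
def Ecal (D : ℕ) (a₁ a₂ : ℕ → ℂ) : ℝ :=
  frakP D * ell D ^ 2 * (‖Sj c' D 1 a₁ a₂‖ + ‖Sj c' D 2 a₁ a₂‖ + ‖Sj c' D 3 a₁ a₂‖)

omit [NeZero D] in
/-- The main term `α⁻¹(½S₁ + 2S₂ + 3/2S₃)𝔓` of Proposition 7.1. [cite: Zhang2022LandauSiegel, §7 Prop. 7.1] -/
def mainMV (D : ℕ) (a₁ a₂ : ℕ → ℂ) : ℂ :=
  (alpha D : ℂ)⁻¹ *
    (1 / 2 * Sj c' D 1 a₁ a₂ + 2 * Sj c' D 2 a₁ a₂ + 3 / 2 * Sj c' D 3 a₁ a₂) * frakP D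

/-- **Proposition 7.1** (§7 p. 13, mean-value formula I; proof pp. 13–15 with (7.3)–(7.21), using
Prop. 2.1, Lemmas 5.1–5.4, 5.6): for `𝐚₁, 𝐚₂` satisfying (7.2),
"`Θ₁(𝐚₁,𝐚₂) = α⁻¹(½S₁ + 2S₂ + 3/2S₃)𝔓 + O(E(𝐚₁,𝐚₂)) + o(𝔓)`". CLAIM.
[cite: Zhang2022LandauSiegel, §7 Prop. 7.1] -/
def Prop71 : Prop :=
  ∀ B : ℝ, ∀ ε : ℝ, 0 < ε → ∃ C : ℝ, ForAllLarge fun D _ χ => AssumptionA D χ →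
    ∀ a₁ a₂ : ℕ → ℂ, Adm72 D B a₁ → Adm72 D B a₂ →
      ‖Theta1 c' χ a₁ a₂ - mainMV c' D a₁ a₂‖ ≤ C * Ecal c' D a₁ a₂ + ε * frakP D

/-- The left side of Lemma 8.1: `Σ_{ψ∈Ψ₁}Σ_{ρ∈𝔷(ψ)} 𝔠*(ρ,ψ)A(𝐚₁;ρ,ψ)A(𝐚₂;1−ρ,ψ̄)ω(ρ)`.
[cite: Zhang2022LandauSiegel, §8 Lemma 8.1] -/
def lhs81 (a₁ a₂ : ℕ → ℂ) : ℂ :=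
  ∑ i ∈ idx χ, cstar c' D i.1 i.2 * Apoly i.1 a₁ i.2 * ApolyBar i.1 a₂ (1 - i.2) * omegaW D i.2

/-- **Lemma 8.1** (§8 p. 16; proof from Prop. 2.2, Lemmas 5.2, 5.9, 6.1, 3.3 and the reflection
`−Ĩ₁⁻(𝐚₁,𝐚₂;ψ) = conj Ĩ₁⁺(𝐚̄₂,𝐚̄₁;ψ)`): for `𝐚₁, 𝐚₂` satisfying (7.2),
"`ΣΣ𝔠*(ρ,ψ)A(𝐚₁;ρ,ψ)A(𝐚₂;1−ρ,ψ̄)ω(ρ) = Θ₁(𝐚₁,𝐚₂) + conj Θ₁(𝐚̄₂,𝐚̄₁) + o(𝔓)`". CLAIM.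
[cite: Zhang2022LandauSiegel, §8 Lemma 8.1] -/
def Lemma81 : Prop :=
  ∀ B : ℝ, ∀ ε : ℝ, 0 < ε → ForAllLarge fun D _ χ => AssumptionA D χ →
    ∀ a₁ a₂ : ℕ → ℂ, Adm72 D B a₁ → Adm72 D B a₂ →
      ‖lhs81 c' χ a₁ a₂ -
          (Theta1 c' χ a₁ a₂ + conj (Theta1 c' χ (fun n => conj (a₂ n)) (fun n => conj (a₁ n))))‖
        ≤ ε * frakP D

/-! ## The sequences of §§8–10, 18 and the reductions to `Θ₁` -/

/-- **`a₁₁(n) = χ(n)(ϰ₁(n) + ι₂ϰ₂(n))`** (8.8) (so `A(𝐚₁₁;s,ψ) = H₁(s,ψ)`).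
[cite: Zhang2022LandauSiegel, §8 (8.8)] -/
def a11 (n : ℕ) : ℂ := χ (n : ZMod D) * (vk1 D n + iota2 * vk2 D n)

/-- **`a₂₁(n) = conj a₁₁(n)`** (8.8). [cite: Zhang2022LandauSiegel, §8 (8.8)] -/
def a21 (n : ℕ) : ℂ := conj (a11 χ n)

/-- **`a₁₂(n) = χ(n)(ῑ₃ϰ₃(n) + ῑ₄ϰ₂(n))`** (9.2) (so `A(𝐚₁₂;s,ψ) = H₂(s,ψ)`).
[cite: Zhang2022LandauSiegel, §9 (9.2)] -/
def a12 (n : ℕ) : ℂ := χ (n : ZMod D) * (conj iota3 * vk3 D n + conj iota4 * vk2 D n)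

/-- **`a₂₂(n) = conj a₁₂(n)`** (9.2) (printed "`= conj a₂₁(n)`", a typo). [cite: Zhang2022LandauSiegel, §9 (9.2)] -/
def a22 (n : ℕ) : ℂ := conj (a12 χ n)

/-- **`a₁₃(n) = χ(n)f̃(log n/log P)`** (§10 p. 20) (so `A(𝐚₁₃;s,ψ) = J₁(s,ψ)`).
[cite: Zhang2022LandauSiegel, §10 p. 20] -/
def a13 (n : ℕ) : ℂ := χ (n : ZMod D) * (ftilde (Real.log n / Real.log (bigP D)) : ℂ)

/-- **`a₁₄(n) = χ(n)f̃(log n/log P + 0.004 − α̃)`** (§10 p. 20) (so `A(𝐚₁₄;s,ψ) = J₂(s,ψ)`).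
[cite: Zhang2022LandauSiegel, §10 p. 20] -/
def a14 (n : ℕ) : ℂ :=
  χ (n : ZMod D) * (ftilde (Real.log n / Real.log (bigP D) + 0.004 - alphaTilde D) : ℂ)

/-- **`a₂₃`** (§18 p. 36, in `Θ₁(𝐚₂₃,𝐚₂₃)` for (18.3)): the coefficients of `J₁`, i.e. `a₂₃ = a₁₃`
(real). [cite: Zhang2022LandauSiegel, §18 (18.3)] -/
def a23 (n : ℕ) : ℂ := a13 χ n

/-- **(8.7)** (§8 p. 16, "By Lemma 8.1"): "`Ξ₁₁ = 2Re{Θ₁(𝐚₁₁,𝐚₂₁)} + o(𝔓)`". CLAIM.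
[cite: Zhang2022LandauSiegel, §8 (8.7)] -/
def Eq87 : Prop :=
  ∀ ε : ℝ, 0 < ε → ForAllLarge fun D _ χ => AssumptionA D χ →
    |xi11 c' χ - 2 * (Theta1 c' χ (a11 χ) (a21 χ)).re| ≤ ε * frakP D

/-- **(9.1)** (§9 p. 19, "By Lemma 8.1"): "`Ξ₁₂ = 2Re{Θ₁(𝐚₁₂,𝐚₂₂)} + o(𝔓)`". CLAIM.
[cite: Zhang2022LandauSiegel, §9 (9.1)] -/
def Eq91 : Prop :=
  ∀ ε : ℝ, 0 < ε → ForAllLarge fun D _ χ => AssumptionA D χ →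
    |xi12 c' χ - 2 * (Theta1 c' χ (a12 χ) (a22 χ)).re| ≤ ε * frakP D

/-- **(10.1)** (§10 p. 20, "By Lemma 8.1"): "`Ξ₁* = Θ₁(𝐚₁₁,𝐚₁₃) + conj Θ₁(𝐚₁₃,𝐚₂₁) + Θ₁(𝐚₁₄,𝐚₂₂)
+ conj Θ₁(𝐚₁₂,𝐚₁₄) + o(𝔓)`". CLAIM. [cite: Zhang2022LandauSiegel, §10 (10.1)] -/
def Eq101 : Prop :=
  ∀ ε : ℝ, 0 < ε → ForAllLarge fun D _ χ => AssumptionA D χ →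
    ‖xiStar1 c' χ - (Theta1 c' χ (a11 χ) (a13 χ) + conj (Theta1 c' χ (a13 χ) (a21 χ)) +
        Theta1 c' χ (a14 χ) (a22 χ) + conj (Theta1 c' χ (a12 χ) (a14 χ)))‖ ≤ ε * frakP D

/-- **(18.3)** (§18 p. 36, "By Lemma 8.1"): "`ΣΣ𝔠*|J₁(ρ,ψ)|²ω(ρ) = 2Re{Θ₁(𝐚₂₃,𝐚₂₃)} + o(𝔓)`"
(the printed display omits `𝔠*`). CLAIM. [cite: Zhang2022LandauSiegel, §18 (18.3)] -/
def Eq183 : Prop :=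
  ∀ ε : ℝ, 0 < ε → ForAllLarge fun D _ χ => AssumptionA D χ →
    |xiJ c' χ - 2 * (Theta1 c' χ (a23 χ) (a23 χ)).re| ≤ ε * frakP D

end MeanValue

end Literature.NumberTheory.LFunctions.Zhang2022.Skeleton
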